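import Mathlib
import Literature.Combinatorics.Additive.NeumannTPPSubgroupIndex
import Literature.RepresentationTheory.FiniteGroups.AbelianSubgroupDegreeBound
import HarnessLib

/-!
# AbelianSubgroupIndexCharDegreeBound

Topic `Literature/RepresentationTheory/FiniteGroups`. Named literature fact(s) relocated by the gate from `Summits/MatrixMultiplication/MatrixMultiplication/Theorems/CNonabelianTPPFamilies/Negative/CNonabelianTPPFamiliesFalseOfCHMN2015Thm8.lean`
(accept-time relocation of `[cite]`d propositions written inline in a Summits proposal; human ruling 2026-08-15).
Sources: CosseyHalasiMarotiNguyen2015.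

* `Literature.RepresentationTheory.FiniteGroups.CHMN2015_thm8`
-/

namespace Literature.RepresentationTheory.FiniteGroups

open Literature.Combinatorics.Additive Literature.RepresentationTheory.FiniteGroups

/-- **Cossey–Halasi–Maróti–Nguyen 2015, Thm. 8 (first part; depends on CFSG).** "Every finite group `G`
contains an abelian subnormal subgroup of index at most `b(G)^8`", `b(G)` the largest irreducible
character degree (the tree's `maxCharDegree G`).  Stated here in the weaker form actually used — an
ABELIAN subgroup of index `≤ d_max(G)^8` (subnormality dropped).
-- TODO(general form): the subgroup can be taken subnormal; also a solvable subgroup of index ≤ b(G)².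
[cite: CosseyHalasiMarotiNguyen2015, Thm. 8] [file RepresentationTheory/FiniteGroups/AbelianSubgroupIndexCharDegreeBound] -/
def CHMN2015_thm8 : Prop :=
  ∀ (G : Type) [Group G] [Finite G], ∃ K : Subgroup G, IsMulCommutative K ∧ K.index ≤ maxCharDegree G ^ 8

end Literature.RepresentationTheory.FiniteGroups
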